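import Summits.Ventures.CertifiedManyBodySolver.Transport.PauliMarkovMatrixDensity
import Literature.MathematicalPhysics.QuantumLattice.HubbardWindowCertificateD4
import HarnessLib

/-!
# Ventures/CertifiedManyBodySolver — Transport/PauliMarkovMatrixD4.lean

HONEST FRAMING: first certified bounds; not a superconductivity verdict; every number certified or labelled float.

**`D₄`-equivariance of the Pauli–Markov row operators (square lattice, `d = 2`).** A reduce-mode
square-lattice certificate identifies monomials with their images under the point group; on the
thermodynamic-limit state class (I) of `ℤ²` its soundness theorem
(`InfVolFermionState.IsTorusLimitOf.re_sum_expect_d4_ge_of_window_certificate_TT'_ineq`, `t' = 0`) bounds the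
ORBIT MEAN `|S|⁻¹ Σ_γ Re ω_{γΛ}(Γ(d4Emb γ 0) X')` of the objective. When PM / PMP rows are moved into the
objective, `X' = X − Σ_i κ_i (B_i 𝟙 − O_i)`, each orbit term needs the row bound for the TRANSPORTED operator
`Γ(d4Emb γ 0) O_i ∈ 𝔄_{γΛ}`. This file supplies it:

* `expect_fermionEmbed_d4Emb_pmpOp`: `ω(Γ(d4Emb γ 0) O_{S,Λ}) = Σ_{r∈S} tr(Λ_r G_ω(γ·r))` — the transported
  row is the PMP row of the image data `(γS, Λ ∘ γ⁻¹)` (`d4Image`, `d4Pullback`; `sum_d4Image`);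
* `re_expect_fermionEmbed_d4Emb_pmpOp_le`: `Re ω(Γ(d4Emb γ 0) O_{S,Λ}) ≤ pmpValue ν (γS) (Λ∘γ⁻¹)` for
  translation-invariant `ω` (`ν = ω(n_{0τ})`), and the scalar twin `re_expect_fermionEmbed_d4Emb_pmOpZd_le`
  (`≤ pmValueZd (γS) (λ∘γ⁻¹)`);
* the orbit-term slack forms `re_expect_fermionEmbed_d4Emb_sub_pmpSlack_le` /
  `re_expect_fermionEmbed_d4Emb_sub_pmZdSlack_le`: with the reader's bounds `B_i ≥ pmpValue ν (γS_i) (Λ_i∘γ⁻¹)`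
  (resp. `pmValueZd`) for the group element `γ` at hand,
  `Re ω(Γ(d4Emb γ 0)(X − Σ_i κ_i (B_i 𝟙 − O_i))) ≤ Re ω(Γ(d4Emb γ 0) X)`.

(For op-02's `D₄`-orbit-summed directions the image data coincide with the original ones and the same
`B_i` serves every `γ`; this file does not need that.) No physical notion is defined (abbreviations
`d4Image`, `d4Pullback`), no named fact, no sorry.

References: op-02 PM-2D.md §4/§7.4 (rows are `D₄`-symmetrised); the tree's `HubbardWindowCertificateD4`
(`PolySite.d4Emb`) and `HubbardNNNHoppingTorusLimitCorrelator` (orbit-mean soundness on class (I)).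
-/

noncomputable section

namespace Summit.Ventures.CertifiedManyBodySolver.Transport

open Matrix Finset MeasureTheory
open Literature.Probability.LatticeModels
open Literature.MathematicalPhysics.QuantumLattice HubbardWave0
open scoped ComplexOrder Real

/-! ### §1. Image data under a point-group element -/

/-- The image support `γS = {γ·r : r ∈ S}`. -/
def d4Image (γ : DihedralGroup 4) (S : Finset (Site 2)) : Finset (Site 2) :=
  S.map ⟨d4Vec γ, d4Vec_injective γ⟩

/-- The pulled-back coefficient family `(Λ ∘ γ⁻¹)(r') = Λ(γ⁻¹ r')` (via a left inverse of `d4Vec γ`). -/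
def d4Pullback {M : Type*} (γ : DihedralGroup 4) (Lam : Site 2 → M) : Site 2 → M :=
  fun r' => Lam (Function.invFun (d4Vec γ) r')

/-- `(Λ ∘ γ⁻¹)(γ r) = Λ r`. -/
theorem d4Pullback_d4Vec {M : Type*} (γ : DihedralGroup 4) (Lam : Site 2 → M) (r : Site 2) :
    d4Pullback γ Lam (d4Vec γ r) = Lam r :=
  congrArg Lam (Function.leftInverse_invFun (d4Vec_injective γ) r)

/-- Reindexing a row over the image data: `Σ_{r'∈γS} f(r', (Λ∘γ⁻¹)(r')) = Σ_{r∈S} f(γ r, Λ r)`. -/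
theorem sum_d4Image {M β : Type*} [AddCommMonoid β] (γ : DihedralGroup 4) (S : Finset (Site 2))
    (Lam : Site 2 → M) (f : Site 2 → M → β) :
    ∑ r' ∈ d4Image γ S, f r' (d4Pullback γ Lam r') = ∑ r ∈ S, f (d4Vec γ r) (Lam r) := by
  rw [d4Image, Finset.sum_map]
  refine Finset.sum_congr rfl fun r _ => ?_
  simp only [Function.Embedding.coeFn_mk, d4Pullback_d4Vec]

/-- `γ·0 = 0`. -/
theorem d4Vec_zero (γ : DihedralGroup 4) : d4Vec γ (0 : Site 2) = 0 := (d4Vec_eq_zero_iff γ 0).2 rfl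

/-! ### §2. The transported letters and row operators -/

section Transported

variable (ω : InfVolFermionState 2) (σ τ : Fin 2) (γ : DihedralGroup 4) {Λ : Finset (Site 2)}

/-- `Γ(d4Emb γ 0) A_j(x) = A_j(γ x + 0)`. -/
theorem fermionEmbed_d4Emb_letterOp (j : Fin 2) (x : Site 2) (hx : x ∈ Λ) :
    fermionEmbed (PolySite.d4Emb γ 0 Λ) (letterOp j x hx σ τ) =
      letterOp j (d4Vec γ x + 0) (d4Vec_add_mem_d4ShiftSet γ 0 hx) σ τ := by
  fin_cases j
  · simp only [Fin.zero_eta, letterOp_zero]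
    exact fermionEmbed_annihilation _ _ _
  · simp only [Fin.mk_one, letterOp_one, map_mul]
    rw [nAt, fermionEmbed_numberOp]
    exact congrArg₂ (· * ·) rfl (fermionEmbed_annihilation _ _ _)

/-- **`ω(Γ(d4Emb γ 0) O_{S,Λ}) = Σ_{r∈S} tr(Λ_r G_ω(γ r))`** (the transported PMP row operator has the row value
of the image data). -/
theorem expect_fermionEmbed_d4Emb_pmpOp (S : Finset (Site 2)) (Lam : Site 2 → Matrix (Fin 2) (Fin 2) ℂ)
    (h0 : (0 : Site 2) ∈ Λ) (hmem : ∀ r ∈ S, r ∈ Λ) :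
    ω.expect (d4ShiftSet γ 0 Λ) (fermionEmbed (PolySite.d4Emb γ 0 Λ) (pmpOp S Lam σ τ Λ h0 hmem)) =
      ∑ r ∈ S, (Lam r * letterTwoPoint ω σ τ (d4Vec γ r)).trace := by
  rw [pmpOp, map_sum, map_sum, ← Finset.sum_attach S (fun r => (Lam r * letterTwoPoint ω σ τ (d4Vec γ r)).trace)]
  refine Finset.sum_congr rfl fun r _ => ?_
  simp_rw [map_sum]
  rw [Matrix.trace, Finset.sum_comm]
  refine Finset.sum_congr rfl fun l _ => ?_
  rw [Matrix.diag_apply, Matrix.mul_apply]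
  refine Finset.sum_congr rfl fun j _ => ?_
  rw [map_smul, map_smul, smul_eq_mul, map_mul, fermionEmbed_conjTranspose, fermionEmbed_d4Emb_letterOp,
    fermionEmbed_d4Emb_letterOp, expect_letterOp_conjTranspose_mul, d4Vec_zero, add_zero, add_zero,
    letterTwoPoint_apply]

/-- Scalar twin: `ω(Γ(d4Emb γ 0) O_{S,λ}) = Σ_{r∈S} λ_r ω(c†_{0σ} c_{γr,σ})`. -/
theorem expect_fermionEmbed_d4Emb_pmOpZd (S : Finset (Site 2)) (lam : Site 2 → ℝ) (h0 : (0 : Site 2) ∈ Λ)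
    (hmem : ∀ r ∈ S, r ∈ Λ) :
    ω.expect (d4ShiftSet γ 0 Λ) (fermionEmbed (PolySite.d4Emb γ 0 Λ) (pmOpZd S lam σ Λ h0 hmem)) =
      ∑ r ∈ S, ((lam r : ℝ) : ℂ) * ω.twoPoint σ 0 (d4Vec γ r) := by
  rw [pmOpZd, map_sum, map_sum, ← Finset.sum_attach S (fun r => ((lam r : ℝ) : ℂ) * ω.twoPoint σ 0 (d4Vec γ r))]
  refine Finset.sum_congr rfl fun r _ => ?_
  rw [map_smul, map_smul, smul_eq_mul, map_mul, fermionEmbed_conjTranspose]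
  have h1 : fermionEmbed (PolySite.d4Emb γ 0 Λ) (cAt 0 h0 σ) =
      cAt (d4Vec γ 0 + 0) (d4Vec_add_mem_d4ShiftSet γ 0 h0) σ := fermionEmbed_annihilation _ _ _
  have h2 : fermionEmbed (PolySite.d4Emb γ 0 Λ) (cAt r.1 (hmem r r.2) σ) =
      cAt (d4Vec γ r.1 + 0) (d4Vec_add_mem_d4ShiftSet γ 0 (hmem r r.2)) σ := fermionEmbed_annihilation _ _ _
  rw [h1, h2, ω.expect_creation_mul_annihilation, d4Vec_zero, add_zero, add_zero]

/-- **Row bound for the transported PMP operator**: for translation-invariant `ω` and `σ ≠ τ`,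
`Re ω(Γ(d4Emb γ 0) O_{S,Λ}) ≤ pmpValue ν (γS) (Λ∘γ⁻¹)`, `ν = ω(n_{0τ})`. -/
theorem re_expect_fermionEmbed_d4Emb_pmpOp_le (hω : ω.IsTranslationInvariant) (hστ : σ ≠ τ) (S : Finset (Site 2))
    (Lam : Site 2 → Matrix (Fin 2) (Fin 2) ℂ) (h0 : (0 : Site 2) ∈ Λ) (hmem : ∀ r ∈ S, r ∈ Λ) :
    (ω.expect (d4ShiftSet γ 0 Λ) (fermionEmbed (PolySite.d4Emb γ 0 Λ) (pmpOp S Lam σ τ Λ h0 hmem))).re ≤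
      pmpValue (spinDensity ω τ) (d4Image γ S) (d4Pullback γ Lam) := by
  have h := hω.pauliMarkovMatrix_sigma ω σ τ hστ (d4Image γ S) (d4Pullback γ Lam)
  rw [sum_d4Image γ S Lam (fun r' M => ((M * letterTwoPoint ω σ τ r').trace).re)] at h
  rw [expect_fermionEmbed_d4Emb_pmpOp, Complex.re_sum]
  exact h

/-- **Row bound for the transported scalar PM operator**: `Re ω(Γ(d4Emb γ 0) O_{S,λ}) ≤ pmValueZd (γS) (λ∘γ⁻¹)`. -/
theorem re_expect_fermionEmbed_d4Emb_pmOpZd_le (hω : ω.IsTranslationInvariant) (S : Finset (Site 2))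
    (lam : Site 2 → ℝ) (h0 : (0 : Site 2) ∈ Λ) (hmem : ∀ r ∈ S, r ∈ Λ) :
    (ω.expect (d4ShiftSet γ 0 Λ) (fermionEmbed (PolySite.d4Emb γ 0 Λ) (pmOpZd S lam σ Λ h0 hmem))).re ≤
      pmValueZd (d4Image γ S) (d4Pullback γ lam) := by
  have h := hω.pauliMarkovZd ω σ (d4Image γ S) (d4Pullback γ lam)
  rw [sum_d4Image γ S lam (fun r' c => c * (ω.twoPoint σ 0 r').re)] at h
  rw [expect_fermionEmbed_d4Emb_pmOpZd, Complex.re_sum]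
  simp_rw [Complex.re_ofReal_mul]
  exact h

/-! ### §3. Orbit-term slack forms -/

/-- **Orbit-term slack form (PMP rows).** With multipliers `κ_i ≥ 0` and the reader's bounds for the group
element `γ`, `pmpValue ν_i (γS_i) (Λ_i∘γ⁻¹) ≤ B_i` (`ν_i = ω(n_{0τ_i})`):
`Re ω(Γ(d4Emb γ 0)(X − Σ_i κ_i (B_i 𝟙 − O_i))) ≤ Re ω(Γ(d4Emb γ 0) X)`. -/
theorem re_expect_fermionEmbed_d4Emb_sub_pmpSlack_le (hω : ω.IsTranslationInvariant) (h0 : (0 : Site 2) ∈ Λ)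
    {ι : Type*} (s : Finset ι) (σ τ : ι → Fin 2) (hστ : ∀ i ∈ s, σ i ≠ τ i) (S : ι → Finset (Site 2))
    (Lam : ι → Site 2 → Matrix (Fin 2) (Fin 2) ℂ) (hmem : ∀ i, ∀ r ∈ S i, r ∈ Λ) (κ B : ι → ℝ)
    (hκ : ∀ i ∈ s, 0 ≤ κ i)
    (hB : ∀ i ∈ s, pmpValue (spinDensity ω (τ i)) (d4Image γ (S i)) (d4Pullback γ (Lam i)) ≤ B i)
    (X : FermionOp Λ) :
    (ω.expect (d4ShiftSet γ 0 Λ) (fermionEmbed (PolySite.d4Emb γ 0 Λ) (X - ∑ i ∈ s, ((κ i : ℝ) : ℂ) •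
      (((B i : ℝ) : ℂ) • (1 : FermionOp Λ) - pmpOp (S i) (Lam i) (σ i) (τ i) Λ h0 (hmem i))))).re ≤
      (ω.expect (d4ShiftSet γ 0 Λ) (fermionEmbed (PolySite.d4Emb γ 0 Λ) X)).re := by
  rw [map_sub, map_sub, Complex.sub_re, map_sum, map_sum, Complex.re_sum]
  have hnonneg : ∀ i ∈ s, 0 ≤ (ω.expect (d4ShiftSet γ 0 Λ) (fermionEmbed (PolySite.d4Emb γ 0 Λ)
      (((κ i : ℝ) : ℂ) • (((B i : ℝ) : ℂ) • (1 : FermionOp Λ) - pmpOp (S i) (Lam i) (σ i) (τ i) Λ h0 (hmem i))))).re := by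
    intro i hi
    rw [map_smul, map_smul, smul_eq_mul, Complex.re_ofReal_mul, map_sub, map_sub, map_smul, map_one, map_smul,
      ω.expect_one, smul_eq_mul, mul_one, Complex.sub_re, Complex.ofReal_re]
    refine mul_nonneg (hκ i hi) (sub_nonneg.2 ?_)
    exact (re_expect_fermionEmbed_d4Emb_pmpOp_le ω (σ i) (τ i) γ hω (hστ i hi) (S i) (Lam i) h0 (hmem i)).trans
      (hB i hi)
  linarith [Finset.sum_nonneg hnonneg]

/-- **Orbit-term slack form (scalar PM rows)**: with `pmValueZd (γS_i) (λ_i∘γ⁻¹) ≤ B_i`,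
`Re ω(Γ(d4Emb γ 0)(X − Σ_i κ_i (B_i 𝟙 − O_i))) ≤ Re ω(Γ(d4Emb γ 0) X)`. -/
theorem re_expect_fermionEmbed_d4Emb_sub_pmZdSlack_le (hω : ω.IsTranslationInvariant) (h0 : (0 : Site 2) ∈ Λ)
    {ι : Type*} (s : Finset ι) (σ : ι → Fin 2) (S : ι → Finset (Site 2)) (lam : ι → Site 2 → ℝ)
    (hmem : ∀ i, ∀ r ∈ S i, r ∈ Λ) (κ B : ι → ℝ) (hκ : ∀ i ∈ s, 0 ≤ κ i)
    (hB : ∀ i ∈ s, pmValueZd (d4Image γ (S i)) (d4Pullback γ (lam i)) ≤ B i) (X : FermionOp Λ) :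
    (ω.expect (d4ShiftSet γ 0 Λ) (fermionEmbed (PolySite.d4Emb γ 0 Λ) (X - ∑ i ∈ s, ((κ i : ℝ) : ℂ) •
      (((B i : ℝ) : ℂ) • (1 : FermionOp Λ) - pmOpZd (S i) (lam i) (σ i) Λ h0 (hmem i))))).re ≤
      (ω.expect (d4ShiftSet γ 0 Λ) (fermionEmbed (PolySite.d4Emb γ 0 Λ) X)).re := by
  rw [map_sub, map_sub, Complex.sub_re, map_sum, map_sum, Complex.re_sum]
  have hnonneg : ∀ i ∈ s, 0 ≤ (ω.expect (d4ShiftSet γ 0 Λ) (fermionEmbed (PolySite.d4Emb γ 0 Λ)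
      (((κ i : ℝ) : ℂ) • (((B i : ℝ) : ℂ) • (1 : FermionOp Λ) - pmOpZd (S i) (lam i) (σ i) Λ h0 (hmem i))))).re := by
    intro i hi
    rw [map_smul, map_smul, smul_eq_mul, Complex.re_ofReal_mul, map_sub, map_sub, map_smul, map_one, map_smul,
      ω.expect_one, smul_eq_mul, mul_one, Complex.sub_re, Complex.ofReal_re]
    refine mul_nonneg (hκ i hi) (sub_nonneg.2 ?_)
    exact (re_expect_fermionEmbed_d4Emb_pmOpZd_le ω (σ i) γ hω (S i) (lam i) h0 (hmem i)).trans (hB i hi)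
  linarith [Finset.sum_nonneg hnonneg]

end Transported

end Summit.Ventures.CertifiedManyBodySolver.Transport

end
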